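import Literature.Barriers.CriticalPhenomena.PlaquetteWalkHoleRootWoundStraddle
import HarnessLib

/-!
# Barrier catalogue (SAWScalingLimit): the EXTREME ROWS of a Glazman–Manolescu walk — no arc leaves the topmost row upward,
every run inside it begins and ends with a TURN, and a wound walk has such turns in two different rows («EXTREME ROWS»)

Second brick of the «WOUND COST ≥ 5» programme (DESIGN-next b-engine-1 g23 §2.1), after `PlaquetteWalkHoleRootWoundStraddle`
(a wound excursion draws arcs strictly above and strictly below the hole row). For a walk `γ` (its `i`-th arc lies in the
plaquette `fc i`, entering through the side `sIn i`, leaving through `sOut i`):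

* ADJACENCY (`fc_succ_eq_of_sOut_N/S`, `fc_pred_eq_of_sIn_N/S`, `fc_succ_row_of_sOut_WE`, `fc_pred_row_of_sIn_WE`): an arc leaving
  through `N` is followed by an arc in the plaquette above; through `W`/`E` by an arc in the same row; etc.
* ROW MAXIMUM (`sOut_ne_N_of_le`, `sIn_ne_N_of_le`): if every arc lies in a row `≤ Y`, an arc in row `Y` neither enters nor leaves
  through `N` (except the boundary arcs `0` / `last`); dually for the row minimum and `S`.
* ★ RUN ENDS (`sIn_eq_S_of_first_in_row`, `sOut_eq_S_of_last_in_row` and the `N`-duals): the first arc of a maximal run of arcs in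
  the top row ENTERS THROUGH `S` and leaves sideways — a corner or co-corner arc —, the last one leaves through `S`.
* ★★ FOR A WOUND CLASS-`B2a` WALK from a hole root (`exists_top_entry_corner`, `exists_bottom_entry_corner`, `exists_entry_corners`):
  its topmost row lies strictly above the hole row and its bottommost row strictly below (WOUND STRADDLE), the first arc lies in the
  root plaquette, so the top row and the bottom row each contain an ENTRY CORNER ARC (`{S, W}`/`{S, E}` above, `{N, W}`/`{N, E}`
  below) at indices `≥ 1` — two turning arcs in two different plaquettes of two different rows.

* ★ SINGLE VISIT (`YBWalk.exists_N_of_fc_eq`: two different arcs in one plaquette use its four sides; `ΩG.forall_top_ne_N`: no arc of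
  a class-`B2a` walk — first and last included — uses the `N` side of a top-row plaquette; `ΩG.top_single_visit`): the top-row
  plaquettes of a class-`B2a` walk are singly visited, so their turns are ISOLATED turns;
* ★★ `ΩG.top_exit_or_end` — besides the entry turn, the LAST top-row arc is a second turn (leaving through `S`, in another
  plaquette) unless it is the walk's last arc ending on a VERTICAL side of `r` (then `r` lies in the top row): the one exception.

Not here (the last brick): the count `n_{u₁} + n_{u₂} ≥ 4 − [exception]` over both extreme rows and the parity lift
(`PlaquetteWalkAngleCostParity`) to cost `≥ 5`. [GlazmanManolescu2019 §1 Fig. 1; Glazman 2015 Lemma 3.1]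
-/

noncomputable section

namespace Literature.Probability.RandomPlanarGeometry.SAW.YangBaxter

open Real

open private fc_fh fc_ne fh_add_Mv three_le_Mv from Literature.Probability.RandomPlanarGeometry.YangBaxterSAWGeneralDomain

/-! ## Which plaquettes have a given vertical side -/

/-- A vertical mid-edge `vert x y` is the `W` side of `(x, y)` and the `E` side of `(x − 1, y)`. [cite: GlazmanManolescu2019, §1 (the tiling)] -/
theorem eq_of_side_eq_vert {f : Face} {s : Side} {x y : ℤ} (h : f.side s = .vert x y) :
    (f = (x, y) ∧ s = .W) ∨ (f = (x - 1, y) ∧ s = .E) := by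
  obtain ⟨k, j⟩ := f
  cases s <;> simp [Face.side] at h ⊢
  · exact ⟨h.1, h.2⟩
  · exact ⟨by omega, h.2⟩

namespace YBWalk

variable {D : Set Face} {a z : MidEdge} (γ : YBWalk D a z)

/-! ## Adjacency of consecutive arcs -/

/-- An arc leaving through `N` is followed by an arc in the plaquette ABOVE. [cite: GlazmanManolescu2019, §1, Fig. 1 (consecutive arcs lie in different rhombi)] -/
theorem fc_succ_eq_of_sOut_N {i : ℕ} (hi : i + 1 < γ.arcs.length) (hN : γ.sOut i = .N) :
    γ.fc (i + 1) = ((γ.fc i).1, (γ.fc i).2 + 1) := by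
  obtain ⟨-, hout⟩ := γ.side_sIn_eq_nth (show i < γ.arcs.length by omega)
  obtain ⟨hin, -⟩ := γ.side_sIn_eq_nth hi
  rw [hN] at hout
  have e : (γ.fc (i + 1)).side (γ.sIn (i + 1)) = .slant (γ.fc i).1 ((γ.fc i).2 + 1) := by
    rw [hin, ← hout]; obtain ⟨k, j⟩ := γ.fc i; rfl
  rcases eq_of_side_eq_slant e with ⟨h1, -⟩ | ⟨h1, -⟩
  · exact h1
  · exfalso; refine γ.fc_succ_ne hi ?_
    rw [h1]; obtain ⟨k, j⟩ := γ.fc i; simp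

/-- An arc leaving through `S` is followed by an arc in the plaquette BELOW. [cite: GlazmanManolescu2019, §1, Fig. 1] -/
theorem fc_succ_eq_of_sOut_S {i : ℕ} (hi : i + 1 < γ.arcs.length) (hS : γ.sOut i = .S) :
    γ.fc (i + 1) = ((γ.fc i).1, (γ.fc i).2 - 1) := by
  obtain ⟨-, hout⟩ := γ.side_sIn_eq_nth (show i < γ.arcs.length by omega)
  obtain ⟨hin, -⟩ := γ.side_sIn_eq_nth hi
  rw [hS] at hout
  have e : (γ.fc (i + 1)).side (γ.sIn (i + 1)) = .slant (γ.fc i).1 (γ.fc i).2 := by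
    rw [hin, ← hout]; obtain ⟨k, j⟩ := γ.fc i; rfl
  rcases eq_of_side_eq_slant e with ⟨h1, -⟩ | ⟨h1, -⟩
  · exfalso; refine γ.fc_succ_ne hi ?_
    rw [h1]
  · exact h1

/-- An arc entering through `N` is preceded by an arc in the plaquette ABOVE. [cite: GlazmanManolescu2019, §1, Fig. 1] -/
theorem fc_pred_eq_of_sIn_N {i : ℕ} (hi : i < γ.arcs.length) (h1 : 1 ≤ i) (hN : γ.sIn i = .N) :
    γ.fc (i - 1) = ((γ.fc i).1, (γ.fc i).2 + 1) := by
  obtain ⟨hin, -⟩ := γ.side_sIn_eq_nth hi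
  have hi' : i - 1 + 1 < γ.arcs.length := by omega
  obtain ⟨-, hout⟩ := γ.side_sIn_eq_nth (show i - 1 < γ.arcs.length by omega)
  rw [show i - 1 + 1 = i by omega] at hout
  rw [hN] at hin
  have e : (γ.fc (i - 1)).side (γ.sOut (i - 1)) = .slant (γ.fc i).1 ((γ.fc i).2 + 1) := by
    rw [hout, ← hin]; obtain ⟨k, j⟩ := γ.fc i; rfl
  rcases eq_of_side_eq_slant e with ⟨h2, -⟩ | ⟨h2, -⟩
  · exact h2
  · exfalso; refine γ.fc_succ_ne hi' ?_
    rw [show i - 1 + 1 = i by omega, h2]; obtain ⟨k, j⟩ := γ.fc i; simp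

/-- An arc entering through `S` is preceded by an arc in the plaquette BELOW. [cite: GlazmanManolescu2019, §1, Fig. 1] -/
theorem fc_pred_eq_of_sIn_S {i : ℕ} (hi : i < γ.arcs.length) (h1 : 1 ≤ i) (hS : γ.sIn i = .S) :
    γ.fc (i - 1) = ((γ.fc i).1, (γ.fc i).2 - 1) := by
  obtain ⟨hin, -⟩ := γ.side_sIn_eq_nth hi
  have hi' : i - 1 + 1 < γ.arcs.length := by omega
  obtain ⟨-, hout⟩ := γ.side_sIn_eq_nth (show i - 1 < γ.arcs.length by omega)
  rw [show i - 1 + 1 = i by omega] at hout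
  rw [hS] at hin
  have e : (γ.fc (i - 1)).side (γ.sOut (i - 1)) = .slant (γ.fc i).1 (γ.fc i).2 := by
    rw [hout, ← hin]; obtain ⟨k, j⟩ := γ.fc i; rfl
  rcases eq_of_side_eq_slant e with ⟨h2, -⟩ | ⟨h2, -⟩
  · exfalso; refine γ.fc_succ_ne hi' ?_
    rw [show i - 1 + 1 = i by omega, h2]
  · exact h2

/-- An arc entering through a VERTICAL side (`W` or `E`) is preceded by an arc in the SAME ROW. [cite: GlazmanManolescu2019, §1, Fig. 1] -/
theorem fc_pred_row_of_sIn_WE {i : ℕ} (hi : i < γ.arcs.length) (h1 : 1 ≤ i) (hWE : γ.sIn i = .W ∨ γ.sIn i = .E) :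
    (γ.fc (i - 1)).2 = (γ.fc i).2 := by
  obtain ⟨hin, -⟩ := γ.side_sIn_eq_nth hi
  obtain ⟨-, hout⟩ := γ.side_sIn_eq_nth (show i - 1 < γ.arcs.length by omega)
  rw [show i - 1 + 1 = i by omega] at hout
  rcases hfc : γ.fc i with ⟨k, j⟩
  rcases hWE with hW | hE
  · rw [hW] at hin
    have e : (γ.fc (i - 1)).side (γ.sOut (i - 1)) = .vert k j := by rw [hout, ← hin, hfc]; rfl
    rcases eq_of_side_eq_vert e with ⟨h2, -⟩ | ⟨h2, -⟩ <;> simp [h2]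
  · rw [hE] at hin
    have e : (γ.fc (i - 1)).side (γ.sOut (i - 1)) = .vert (k + 1) j := by rw [hout, ← hin, hfc]; rfl
    rcases eq_of_side_eq_vert e with ⟨h2, -⟩ | ⟨h2, -⟩ <;> simp [h2]

/-- An arc leaving through a VERTICAL side is followed by an arc in the SAME ROW. [cite: GlazmanManolescu2019, §1, Fig. 1] -/
theorem fc_succ_row_of_sOut_WE {i : ℕ} (hi : i + 1 < γ.arcs.length) (hWE : γ.sOut i = .W ∨ γ.sOut i = .E) :
    (γ.fc (i + 1)).2 = (γ.fc i).2 := by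
  obtain ⟨-, hout⟩ := γ.side_sIn_eq_nth (show i < γ.arcs.length by omega)
  obtain ⟨hin, -⟩ := γ.side_sIn_eq_nth hi
  rcases hfc : γ.fc i with ⟨k, j⟩
  rcases hWE with hW | hE
  · rw [hW] at hout
    have e : (γ.fc (i + 1)).side (γ.sIn (i + 1)) = .vert k j := by rw [hin, ← hout, hfc]; rfl
    rcases eq_of_side_eq_vert e with ⟨h2, -⟩ | ⟨h2, -⟩ <;> simp [h2]
  · rw [hE] at hout
    have e : (γ.fc (i + 1)).side (γ.sIn (i + 1)) = .vert (k + 1) j := by rw [hin, ← hout, hfc]; rfl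
    rcases eq_of_side_eq_vert e with ⟨h2, -⟩ | ⟨h2, -⟩ <;> simp [h2]

/-! ## The row maximum / minimum: no arc leaves it outward -/

/-- In the topmost row no inner arc LEAVES through `N`. [cite: GlazmanManolescu2019, §1, Fig. 1] -/
theorem sOut_ne_N_of_le {Y : ℤ} (hY : ∀ j < γ.arcs.length, (γ.fc j).2 ≤ Y) {i : ℕ} (hi : i + 1 < γ.arcs.length)
    (h : (γ.fc i).2 = Y) : γ.sOut i ≠ .N := fun hN => by
  have e := γ.fc_succ_eq_of_sOut_N hi hN
  have := hY (i + 1) hi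
  rw [e] at this; simp only at this; omega

/-- In the topmost row no inner arc ENTERS through `N`. [cite: GlazmanManolescu2019, §1, Fig. 1] -/
theorem sIn_ne_N_of_le {Y : ℤ} (hY : ∀ j < γ.arcs.length, (γ.fc j).2 ≤ Y) {i : ℕ} (hi : i < γ.arcs.length) (h1 : 1 ≤ i)
    (h : (γ.fc i).2 = Y) : γ.sIn i ≠ .N := fun hN => by
  have e := γ.fc_pred_eq_of_sIn_N hi h1 hN
  have := hY (i - 1) (by omega)
  rw [e] at this; simp only at this; omega

/-- In the bottommost row no inner arc LEAVES through `S`. [cite: GlazmanManolescu2019, §1, Fig. 1] -/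
theorem sOut_ne_S_of_ge {Y : ℤ} (hY : ∀ j < γ.arcs.length, Y ≤ (γ.fc j).2) {i : ℕ} (hi : i + 1 < γ.arcs.length)
    (h : (γ.fc i).2 = Y) : γ.sOut i ≠ .S := fun hS => by
  have e := γ.fc_succ_eq_of_sOut_S hi hS
  have := hY (i + 1) hi
  rw [e] at this; simp only at this; omega

/-- In the bottommost row no inner arc ENTERS through `S`. [cite: GlazmanManolescu2019, §1, Fig. 1] -/
theorem sIn_ne_S_of_ge {Y : ℤ} (hY : ∀ j < γ.arcs.length, Y ≤ (γ.fc j).2) {i : ℕ} (hi : i < γ.arcs.length) (h1 : 1 ≤ i)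
    (h : (γ.fc i).2 = Y) : γ.sIn i ≠ .S := fun hS => by
  have e := γ.fc_pred_eq_of_sIn_S hi h1 hS
  have := hY (i - 1) (by omega)
  rw [e] at this; simp only at this; omega

/-! ## Runs in the extreme rows begin and end with a turn -/

/-- ★ **ENTRY INTO THE TOP ROW IS A TURN**: an inner arc in the topmost row whose predecessor lies in a lower row enters through
`S` and leaves through `W` or `E` (a corner or co-corner arc). [cite: GlazmanManolescu2019, §1, Fig. 1] -/
theorem sIn_eq_S_of_first_in_row {Y : ℤ} (hY : ∀ j < γ.arcs.length, (γ.fc j).2 ≤ Y) {i : ℕ} (hi : i + 1 < γ.arcs.length)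
    (h1 : 1 ≤ i) (h : (γ.fc i).2 = Y) (hprev : (γ.fc (i - 1)).2 ≠ Y) :
    γ.sIn i = .S ∧ (γ.sOut i = .W ∨ γ.sOut i = .E) := by
  have hi' : i < γ.arcs.length := by omega
  have hS : γ.sIn i = .S := by
    cases hs : γ.sIn i
    · exact absurd ((γ.fc_pred_row_of_sIn_WE hi' h1 (Or.inl hs)).trans h) hprev
    · exact absurd ((γ.fc_pred_row_of_sIn_WE hi' h1 (Or.inr hs)).trans h) hprev
    · rfl
    · exact absurd hs (γ.sIn_ne_N_of_le hY hi' h1 h)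
  refine ⟨hS, ?_⟩
  have hne := γ.sIn_ne_sOut hi'
  rw [hS] at hne
  cases hs : γ.sOut i
  · exact Or.inl rfl
  · exact Or.inr rfl
  · exact absurd hs.symm hne
  · exact absurd hs (γ.sOut_ne_N_of_le hY hi h)

/-- ★ **EXIT FROM THE TOP ROW IS A TURN**: an inner arc in the topmost row whose successor lies in a lower row leaves through `S`
and entered through `W` or `E`. [cite: GlazmanManolescu2019, §1, Fig. 1] -/
theorem sOut_eq_S_of_last_in_row {Y : ℤ} (hY : ∀ j < γ.arcs.length, (γ.fc j).2 ≤ Y) {i : ℕ} (hi : i + 1 < γ.arcs.length)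
    (h1 : 1 ≤ i) (h : (γ.fc i).2 = Y) (hnext : (γ.fc (i + 1)).2 ≠ Y) :
    γ.sOut i = .S ∧ (γ.sIn i = .W ∨ γ.sIn i = .E) := by
  have hi' : i < γ.arcs.length := by omega
  have hS : γ.sOut i = .S := by
    cases hs : γ.sOut i
    · exact absurd ((γ.fc_succ_row_of_sOut_WE hi (Or.inl hs)).trans h) hnext
    · exact absurd ((γ.fc_succ_row_of_sOut_WE hi (Or.inr hs)).trans h) hnext
    · rfl
    · exact absurd hs (γ.sOut_ne_N_of_le hY hi h)
  refine ⟨hS, ?_⟩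
  have hne := γ.sIn_ne_sOut hi'
  rw [hS] at hne
  cases hs : γ.sIn i
  · exact Or.inl rfl
  · exact Or.inr rfl
  · exact absurd hs hne
  · exact absurd hs (γ.sIn_ne_N_of_le hY hi' h1 h)

/-- ★ ENTRY INTO THE BOTTOM ROW IS A TURN (the `N`-dual). [cite: GlazmanManolescu2019, §1, Fig. 1] -/
theorem sIn_eq_N_of_first_in_row {Y : ℤ} (hY : ∀ j < γ.arcs.length, Y ≤ (γ.fc j).2) {i : ℕ} (hi : i + 1 < γ.arcs.length)
    (h1 : 1 ≤ i) (h : (γ.fc i).2 = Y) (hprev : (γ.fc (i - 1)).2 ≠ Y) :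
    γ.sIn i = .N ∧ (γ.sOut i = .W ∨ γ.sOut i = .E) := by
  have hi' : i < γ.arcs.length := by omega
  have hN : γ.sIn i = .N := by
    cases hs : γ.sIn i
    · exact absurd ((γ.fc_pred_row_of_sIn_WE hi' h1 (Or.inl hs)).trans h) hprev
    · exact absurd ((γ.fc_pred_row_of_sIn_WE hi' h1 (Or.inr hs)).trans h) hprev
    · exact absurd hs (γ.sIn_ne_S_of_ge hY hi' h1 h)
    · rfl
  refine ⟨hN, ?_⟩
  have hne := γ.sIn_ne_sOut hi'
  rw [hN] at hne
  cases hs : γ.sOut i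
  · exact Or.inl rfl
  · exact Or.inr rfl
  · exact absurd hs (γ.sOut_ne_S_of_ge hY hi h)
  · exact absurd hs.symm hne

/-- Such an entry arc into the top row is a corner or co-corner arc (it turns). [cite: GlazmanManolescu2019, §1, Fig. 1 (the arc kinds)] -/
theorem arcKind_ne_straight_of_S_WE {s t : Side} (hs : s = .S ∨ s = .N) (ht : t = .W ∨ t = .E) : arcKind s t ≠ .straight := by
  rcases hs with rfl | rfl <;> rcases ht with rfl | rfl <;> decide

end YBWalk

/-! ## Wound class-`B2a` walks: an entry turn in the top row and one in the bottom row -/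

namespace ΩG

variable {D : Set Face} {w r : Face} {ω : ΩG D (w.side .W) r}

/-- The rows of the arcs of a walk with at least one arc, as a non-empty finset. [folklore] -/
private theorem rows_nonempty (h : 0 < ω.2.arcs.length) :
    ((Finset.range ω.2.arcs.length).image fun i => (ω.2.fc i).2).Nonempty :=
  ⟨(ω.2.fc 0).2, Finset.mem_image.2 ⟨0, Finset.mem_range.2 h, rfl⟩⟩

/-- ★★ **AN ENTRY CORNER IN THE TOP ROW**: a wound class-`B2a` walk from a hole root (hole `(w.1 − 1, w.2)` absent) has an
inner arc (index `≥ 1`, not the last) in its TOPMOST row — a row strictly above the hole row — that enters through `S` and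
leaves sideways. [cite: GlazmanManolescu2019, Lemma 2.1; §1, Fig. 1] [cite: CourantRobbins1958, Ch. V Appendix §2 (the even–odd rule)] -/
theorem exists_top_entry_corner (hh : holeFaceW w ∉ D) (hr : RootedFace D (w.side .W) r) (h : ω.IsB2a)
    (hA : ω.AJ hr h (toC (midPt (w.side .W))) ≠ 0) :
    ∃ Y : ℤ, w.2 + 1 ≤ Y ∧ (∀ j < ω.2.arcs.length, (ω.2.fc j).2 ≤ Y) ∧
      ∃ i, 1 ≤ i ∧ i + 1 < ω.2.arcs.length ∧ (ω.2.fc i).2 = Y ∧ ω.2.sIn i = .S ∧ (ω.2.sOut i = .W ∨ ω.2.sOut i = .E) := by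
  classical
  have hlen : 0 < ω.2.arcs.length := by have := ω.fh_lt h; omega
  set S := (Finset.range ω.2.arcs.length).image fun i => (ω.2.fc i).2 with hS
  have hne : S.Nonempty := rows_nonempty hlen
  set Y := S.max' hne with hYdef
  have hY : ∀ j < ω.2.arcs.length, (ω.2.fc j).2 ≤ Y := fun j hj => by
    rw [hYdef]; exact Finset.le_max' S _ (by rw [hS]; exact Finset.mem_image.2 ⟨j, Finset.mem_range.2 hj, rfl⟩)
  obtain ⟨i₁, hi₁, hrow, -⟩ := exists_fc_above_of_wound hr h hA
  have hYge : w.2 + 1 ≤ Y := by have := hY i₁ hi₁; omega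
  -- the FIRST index whose arc lies in row `Y`
  have hex : ∃ i, i < ω.2.arcs.length ∧ (ω.2.fc i).2 = Y := by
    obtain ⟨i, hi, e⟩ := Finset.mem_image.1 (Finset.max'_mem S hne)
    exact ⟨i, Finset.mem_range.1 hi, e⟩
  let i₀ := Nat.find hex
  obtain ⟨hi₀, hrow₀⟩ : i₀ < ω.2.arcs.length ∧ (ω.2.fc i₀).2 = Y := Nat.find_spec hex
  have hmin : ∀ j < i₀, ¬(j < ω.2.arcs.length ∧ (ω.2.fc j).2 = Y) := fun j hj => Nat.find_min hex hj
  -- `i₀ ≥ 1`: the first arc lies in the root plaquette `w`, in the hole row `< Y`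
  have h0 : ω.2.fc 0 = w := fc_zero_eq_root w hh ω.2 hlen
  have hi₀1 : 1 ≤ i₀ := by
    by_contra hlt
    have e0 : i₀ = 0 := by omega
    have := hrow₀; rw [e0, h0] at this; omega
  -- `i₀` is not the last arc: the last arc of a class-B2a walk is followed by nothing, but the arc at `i₀` enters row `Y` from
  -- below through `S`; if `i₀` were the last arc its end `z = r.side ω.1` would be a `W`/`E`/`N` side of a top-row plaquette…
  -- we avoid this case split by using that a wound excursion also has arcs BELOW the hole row after… no: simpler — if `i₀` is the
  -- last index then every arc `j < i₀` lies in rows `< Y`, in particular the first-hit arc in `r`; but the last arc's plaquette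
  -- shares the final mid-edge with `r` (the walk returns to `r`), so it is `r` itself or a neighbour of `r`: rows differ by ≤ 1 —
  -- this does not exclude the case. We therefore allow it: state the conclusion for `i₀` when `i₀ + 1 < length`, else use STRADDLE's
  -- arc below to derive a contradiction with maximality? Not available either. HENCE the honest statement keeps `i + 1 < length`
  -- as a conclusion only when it holds; we split.
  by_cases hlast : i₀ + 1 < ω.2.arcs.length
  · have hprev : (ω.2.fc (i₀ - 1)).2 ≠ Y := fun e => hmin (i₀ - 1) (by omega) ⟨by omega, e⟩
    obtain ⟨hSin, hWE⟩ := ω.2.sIn_eq_S_of_first_in_row hY hlast hi₀1 hrow₀ hprev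
    exact ⟨Y, hYge, hY, i₀, hi₀1, hlast, hrow₀, hSin, hWE⟩
  · -- `i₀` is the last arc: then ALL earlier arcs are in rows `< Y`; but the wound excursion has an arc in a row `≥ w.2 + 1`
    -- at some index `i₁`; if `i₁ < i₀` its row is `< Y`… consistent. Use instead the arc BELOW: irrelevant. We use the return:
    -- the last arc ends on `z = r.side ω.1` and is NOT in `r` (class B2a), while `r = fc firstHitG` has row `< Y` (first hit
    -- index `< i₀`). The last plaquette and `r` share the mid-edge `z`: a vertical `z` forces equal rows (contradiction), a
    -- slanted `z` makes the last plaquette enter `r`'s row-neighbourhood from above through… its `S` side = `z`, i.e. the last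
    -- arc LEAVES through `S` — then its entry is `W`/`E`/`N`; `N` is excluded (sIn ≠ N in the top row for i ≥ 1), and `W`/`E`
    -- entry means the predecessor is in the same row `Y`, contradicting minimality of `i₀` unless … it IS excluded. So sIn = ?
    -- All cases contradict: derive False.
    exfalso
    have hlen1 : i₀ + 1 = ω.2.arcs.length := by omega
    have hF : ω.2.firstHitG < i₀ := by
      by_contra hge
      -- firstHitG ≥ i₀ = length - 1 contradicts `firstHitG + 3 ≤ length`
      have := three_le_Mv hr h; have := fh_add_Mv h; unfold ΩG.Mv at *; omega
    have hrrow : r.2 < Y := by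
      have e := (fc_fh ω hr h).1
      have := hY ω.2.firstHitG (ω.fh_lt h)
      rw [e] at this
      rcases this.lt_or_eq with hlt | heq
      · exact hlt
      · exact absurd ⟨ω.fh_lt h, by rw [e]; exact heq⟩ (hmin _ hF)
    -- the final mid-edge
    obtain ⟨-, hout⟩ := ω.2.side_sIn_eq_nth hi₀
    rw [hlen1, ω.2.nth_length] at hout
    -- `hout : (fc i₀).side (sOut i₀) = r.side ω.1`
    have hlastne : ω.2.fc i₀ ≠ r := fc_ne ω hr h hF hi₀
    rcases hfc : ω.2.fc i₀ with ⟨k, j⟩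
    rw [hfc] at hrow₀ hout hlastne
    simp only at hrow₀
    cases hs : ω.2.sOut i₀
    · -- W: `(k, j).side W = r.side ω.1` ⇒ r = (k, j) or r = (k - 1, j): same row as the top row
      rw [hs] at hout
      have e : r.side ω.1 = .vert k j := by rw [← hout]; rfl
      rcases eq_of_side_eq_vert e with ⟨h2, -⟩ | ⟨h2, -⟩
      · exact hlastne h2.symm
      · have := congrArg Prod.snd h2; simp only at this; omega
    · rw [hs] at hout
      have e : r.side ω.1 = .vert (k + 1) j := by rw [← hout]; rfl
      rcases eq_of_side_eq_vert e with ⟨h2, -⟩ | ⟨h2, -⟩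
      · have := congrArg Prod.snd h2; simp only at this; omega
      · refine hlastne (h2.trans ?_).symm; simp
    · -- S: the entry is W/E (same-row predecessor: contradicts minimality), N (excluded) or S (degenerate)
      have hne := ω.2.sIn_ne_sOut hi₀
      rw [hs] at hne
      have hrow₀' : (ω.2.fc i₀).2 = Y := by rw [hfc]; exact hrow₀
      cases hsi : ω.2.sIn i₀
      · have := ω.2.fc_pred_row_of_sIn_WE hi₀ hi₀1 (Or.inl hsi)
        exact hmin (i₀ - 1) (by omega) ⟨by omega, this.trans hrow₀'⟩
      · have := ω.2.fc_pred_row_of_sIn_WE hi₀ hi₀1 (Or.inr hsi)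
        exact hmin (i₀ - 1) (by omega) ⟨by omega, this.trans hrow₀'⟩
      · exact hne hsi
      · exact ω.2.sIn_ne_N_of_le hY hi₀ hi₀1 hrow₀' hsi
    · -- N: `(k, j).side N = r.side ω.1` ⇒ r = (k, j + 1) above the top row, or r = (k, j)
      rw [hs] at hout
      have e : r.side ω.1 = .slant k (j + 1) := by rw [← hout]; rfl
      rcases eq_of_side_eq_slant e with ⟨h2, -⟩ | ⟨h2, -⟩
      · have := congrArg Prod.snd h2; simp only at this; omega
      · refine hlastne (h2.trans ?_).symm; simp

/-- ★★ **AN ENTRY CORNER IN THE BOTTOM ROW** (the dual, by the same argument with `N`/`S` exchanged): a wound class-`B2a` walk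
from a hole root has an inner arc in its BOTTOMMOST row — strictly below the hole row — entering through `N` and leaving sideways.
[cite: GlazmanManolescu2019, Lemma 2.1; §1, Fig. 1] [cite: CourantRobbins1958, Ch. V Appendix §2 (the even–odd rule)] -/
theorem exists_bottom_entry_corner (hh : holeFaceW w ∉ D) (hr : RootedFace D (w.side .W) r) (h : ω.IsB2a)
    (hA : ω.AJ hr h (toC (midPt (w.side .W))) ≠ 0) :
    ∃ Y : ℤ, Y ≤ w.2 - 1 ∧ (∀ j < ω.2.arcs.length, Y ≤ (ω.2.fc j).2) ∧
      ∃ i, 1 ≤ i ∧ i + 1 < ω.2.arcs.length ∧ (ω.2.fc i).2 = Y ∧ ω.2.sIn i = .N ∧ (ω.2.sOut i = .W ∨ ω.2.sOut i = .E) := by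
  classical
  have hlen : 0 < ω.2.arcs.length := by have := ω.fh_lt h; omega
  set S := (Finset.range ω.2.arcs.length).image fun i => (ω.2.fc i).2 with hS
  have hne : S.Nonempty := rows_nonempty hlen
  set Y := S.min' hne with hYdef
  have hY : ∀ j < ω.2.arcs.length, Y ≤ (ω.2.fc j).2 := fun j hj => by
    rw [hYdef]; exact Finset.min'_le S _ (by rw [hS]; exact Finset.mem_image.2 ⟨j, Finset.mem_range.2 hj, rfl⟩)
  obtain ⟨i₁, hi₁, hrow, -⟩ := exists_fc_below_of_wound ω hr h hA
  have hYle : Y ≤ w.2 - 1 := by have := hY i₁ hi₁; omega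
  have hex : ∃ i, i < ω.2.arcs.length ∧ (ω.2.fc i).2 = Y := by
    obtain ⟨i, hi, e⟩ := Finset.mem_image.1 (Finset.min'_mem S hne)
    exact ⟨i, Finset.mem_range.1 hi, e⟩
  let i₀ := Nat.find hex
  obtain ⟨hi₀, hrow₀⟩ : i₀ < ω.2.arcs.length ∧ (ω.2.fc i₀).2 = Y := Nat.find_spec hex
  have hmin : ∀ j < i₀, ¬(j < ω.2.arcs.length ∧ (ω.2.fc j).2 = Y) := fun j hj => Nat.find_min hex hj
  have h0 : ω.2.fc 0 = w := fc_zero_eq_root w hh ω.2 hlen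
  have hi₀1 : 1 ≤ i₀ := by
    by_contra hlt
    have e0 : i₀ = 0 := by omega
    have := hrow₀; rw [e0, h0] at this; omega
  by_cases hlast : i₀ + 1 < ω.2.arcs.length
  · have hprev : (ω.2.fc (i₀ - 1)).2 ≠ Y := fun e => hmin (i₀ - 1) (by omega) ⟨by omega, e⟩
    obtain ⟨hNin, hWE⟩ := ω.2.sIn_eq_N_of_first_in_row hY hlast hi₀1 hrow₀ hprev
    exact ⟨Y, hYle, hY, i₀, hi₀1, hlast, hrow₀, hNin, hWE⟩
  · exfalso
    have hlen1 : i₀ + 1 = ω.2.arcs.length := by omega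
    have hF : ω.2.firstHitG < i₀ := by
      by_contra hge
      have := three_le_Mv hr h; have := fh_add_Mv h; unfold ΩG.Mv at *; omega
    have hrrow : Y < r.2 := by
      have e := (fc_fh ω hr h).1
      have := hY ω.2.firstHitG (ω.fh_lt h)
      rw [e] at this
      rcases this.lt_or_eq with hlt | heq
      · exact hlt
      · exact absurd ⟨ω.fh_lt h, by rw [e]; exact heq.symm⟩ (hmin _ hF)
    obtain ⟨-, hout⟩ := ω.2.side_sIn_eq_nth hi₀
    rw [hlen1, ω.2.nth_length] at hout
    have hlastne : ω.2.fc i₀ ≠ r := fc_ne ω hr h hF hi₀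
    rcases hfc : ω.2.fc i₀ with ⟨k, j⟩
    rw [hfc] at hrow₀ hout hlastne
    simp only at hrow₀
    cases hs : ω.2.sOut i₀
    · rw [hs] at hout
      have e : r.side ω.1 = .vert k j := by rw [← hout]; rfl
      rcases eq_of_side_eq_vert e with ⟨h2, -⟩ | ⟨h2, -⟩
      · exact hlastne h2.symm
      · have := congrArg Prod.snd h2; simp only at this; omega
    · rw [hs] at hout
      have e : r.side ω.1 = .vert (k + 1) j := by rw [← hout]; rfl
      rcases eq_of_side_eq_vert e with ⟨h2, -⟩ | ⟨h2, -⟩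
      · have := congrArg Prod.snd h2; simp only at this; omega
      · refine hlastne (h2.trans ?_).symm; simp
    · -- S: `(k, j).side S = r.side ω.1` ⇒ r = (k, j) or r = (k, j - 1) below the bottom row
      rw [hs] at hout
      have e : r.side ω.1 = .slant k j := by rw [← hout]; rfl
      rcases eq_of_side_eq_slant e with ⟨h2, -⟩ | ⟨h2, -⟩
      · exact hlastne h2.symm
      · have := congrArg Prod.snd h2; simp only at this; omega
    · have hne := ω.2.sIn_ne_sOut hi₀
      rw [hs] at hne
      have hrow₀' : (ω.2.fc i₀).2 = Y := by rw [hfc]; exact hrow₀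
      cases hsi : ω.2.sIn i₀
      · have := ω.2.fc_pred_row_of_sIn_WE hi₀ hi₀1 (Or.inl hsi)
        exact hmin (i₀ - 1) (by omega) ⟨by omega, this.trans hrow₀'⟩
      · have := ω.2.fc_pred_row_of_sIn_WE hi₀ hi₀1 (Or.inr hsi)
        exact hmin (i₀ - 1) (by omega) ⟨by omega, this.trans hrow₀'⟩
      · exact ω.2.sIn_ne_S_of_ge hY hi₀ hi₀1 hrow₀' hsi
      · exact hne hsi

/-- ★★ **TWO ENTRY TURNS IN TWO ROWS**: a wound class-`B2a` walk from a hole root has a turning (corner or co-corner) inner arc in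
its top row (`≥ w.2 + 1`) and another in its bottom row (`≤ w.2 − 1`) — two different arcs in two different plaquettes.
[cite: GlazmanManolescu2019, Lemma 2.1; §1, Fig. 1] [cite: CourantRobbins1958, Ch. V Appendix §2 (the even–odd rule)] -/
theorem exists_entry_corners (hh : holeFaceW w ∉ D) (hr : RootedFace D (w.side .W) r) (h : ω.IsB2a)
    (hA : ω.AJ hr h (toC (midPt (w.side .W))) ≠ 0) :
    ∃ i i', 1 ≤ i ∧ i + 1 < ω.2.arcs.length ∧ 1 ≤ i' ∧ i' + 1 < ω.2.arcs.length ∧ ω.2.fc i ≠ ω.2.fc i' ∧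
      arcKind (ω.2.sIn i) (ω.2.sOut i) ≠ .straight ∧ arcKind (ω.2.sIn i') (ω.2.sOut i') ≠ .straight ∧
      w.2 + 1 ≤ (ω.2.fc i).2 ∧ (ω.2.fc i').2 ≤ w.2 - 1 := by
  obtain ⟨Y, hY1, -, i, hi1, hi2, hrow, hS, hWE⟩ := exists_top_entry_corner hh hr h hA
  obtain ⟨Y', hY1', -, i', hi1', hi2', hrow', hN, hWE'⟩ := exists_bottom_entry_corner hh hr h hA
  refine ⟨i, i', hi1, hi2, hi1', hi2', fun e => ?_, ?_, ?_, by omega, by omega⟩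
  · have := congrArg Prod.snd e; rw [hrow, hrow'] at this; omega
  · rw [hS]; exact YBWalk.arcKind_ne_straight_of_S_WE (Or.inl rfl) hWE
  · rw [hN]; exact YBWalk.arcKind_ne_straight_of_S_WE (Or.inr rfl) hWE'

end ΩG


namespace YBWalk

variable {D : Set Face} {a z : MidEdge} (γ : YBWalk D a z)

/-! ## Two arcs in one plaquette use its four sides -/

/-- **Two different arcs in the same plaquette use four pairwise distinct sides; in particular one of them uses `N`.**
[cite: GlazmanManolescu2019, §1, Fig. 1 (two arcs in a rhombus: the two corner configurations `w₁`, `w₂`)] -/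
theorem exists_N_of_fc_eq {i j : ℕ} (hi : i < γ.arcs.length) (hj : j < γ.arcs.length) (hij : i ≠ j) (he : γ.fc i = γ.fc j) :
    γ.sIn i = .N ∨ γ.sOut i = .N ∨ γ.sIn j = .N ∨ γ.sOut j = .N := by
  -- wlog i < j; the indices i, i+1, j, j+1 are pairwise distinct (j ≠ i + 1 by `fc_succ_ne`)
  wlog hlt : i < j generalizing i j
  · have := this hj hi (Ne.symm hij) he.symm (by omega)
    tauto
  have hj1 : j ≠ i + 1 := by rintro rfl; exact γ.fc_succ_ne hj he
  obtain ⟨hin_i, hout_i⟩ := γ.side_sIn_eq_nth hi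
  obtain ⟨hin_j, hout_j⟩ := γ.side_sIn_eq_nth hj
  rw [← he] at hin_j hout_j
  -- the four sides are pairwise distinct
  have hsi := γ.sIn_ne_sOut hi
  have hsj : γ.sIn j ≠ γ.sOut j := γ.sIn_ne_sOut hj
  have d1 : γ.sIn i ≠ γ.sIn j := fun e => by
    have := γ.nth_inj (show i ≤ γ.arcs.length by omega) (show j ≤ γ.arcs.length by omega)
      (hin_i.symm.trans (by rw [e]; exact hin_j)); omega
  have d2 : γ.sIn i ≠ γ.sOut j := fun e => by
    have := γ.nth_inj (show i ≤ γ.arcs.length by omega) (show j + 1 ≤ γ.arcs.length by omega)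
      (hin_i.symm.trans (by rw [e]; exact hout_j)); omega
  have d3 : γ.sOut i ≠ γ.sIn j := fun e => by
    have := γ.nth_inj (show i + 1 ≤ γ.arcs.length by omega) (show j ≤ γ.arcs.length by omega)
      (hout_i.symm.trans (by rw [e]; exact hin_j)); omega
  have d4 : γ.sOut i ≠ γ.sOut j := fun e => by
    have := γ.nth_inj (show i + 1 ≤ γ.arcs.length by omega) (show j + 1 ≤ γ.arcs.length by omega)
      (hout_i.symm.trans (by rw [e]; exact hout_j)); omega
  -- four pairwise distinct elements of `Side` exhaust it
  revert hsi hsj d1 d2 d3 d4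
  cases γ.sIn i <;> cases γ.sOut i <;> cases γ.sIn j <;> cases γ.sOut j <;> simp

/-! ## In the topmost row of a walk whose first and last arcs avoid it through `N`, every plaquette is visited once -/

/-- If no arc of the topmost row uses the side `N`, two arcs of the topmost row in the same plaquette coincide: every top-row
plaquette is SINGLY visited. [cite: GlazmanManolescu2019, §1, Fig. 1] -/
theorem eq_of_fc_eq_of_forall_ne_N {Y : ℤ} (hN : ∀ k < γ.arcs.length, (γ.fc k).2 = Y → γ.sIn k ≠ .N ∧ γ.sOut k ≠ .N)
    {i j : ℕ} (hi : i < γ.arcs.length) (hj : j < γ.arcs.length) (hrow : (γ.fc i).2 = Y) (he : γ.fc i = γ.fc j) : i = j := by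
  by_contra hij
  obtain ⟨h1, h2⟩ := hN i hi hrow
  obtain ⟨h3, h4⟩ := hN j hj (by rw [← he]; exact hrow)
  rcases γ.exists_N_of_fc_eq hi hj hij he with e | e | e | e
  · exact h1 e
  · exact h2 e
  · exact h3 e
  · exact h4 e

end YBWalk

namespace ΩG

variable {D : Set Face} {w r : Face} {ω : ΩG D (w.side .W) r}

/-- ★ **NO ARC OF A CLASS-`B2a` WALK USES THE `N` SIDE OF A TOP-ROW PLAQUETTE** — including the first and the last arc: the first lies
in the root plaquette `w` (hole row), the last would otherwise return to `r` from above the top row or from inside `r`.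
[cite: GlazmanManolescu2019, §1, Fig. 1; Lemma 2.1] [cite: Glazman2015WeightedSAW, Lemma 3.1 (proof, pp. 6–7: the classes of walks through a rhombus)] -/
theorem forall_top_ne_N (hh : holeFaceW w ∉ D) (hr : RootedFace D (w.side .W) r) (h : ω.IsB2a) {Y : ℤ}
    (hY : ∀ j < ω.2.arcs.length, (ω.2.fc j).2 ≤ Y) (hYw : w.2 < Y) :
    ∀ k < ω.2.arcs.length, (ω.2.fc k).2 = Y → ω.2.sIn k ≠ .N ∧ ω.2.sOut k ≠ .N := by
  intro k hk hrow
  have hlen : 0 < ω.2.arcs.length := by omega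
  have h0 : ω.2.fc 0 = w := fc_zero_eq_root w hh ω.2 hlen
  have hk1 : 1 ≤ k := by
    by_contra hlt
    have e0 : k = 0 := by omega
    rw [e0, h0] at hrow; omega
  refine ⟨ω.2.sIn_ne_N_of_le hY hk hk1 hrow, ?_⟩
  by_cases hlast : k + 1 < ω.2.arcs.length
  · exact ω.2.sOut_ne_N_of_le hY hlast hrow
  · -- the last arc: its exit is the end `z = r.side ω.1`; `N` would put `r` above the top row or make `r` the last plaquette
    intro hN
    have hlen1 : k + 1 = ω.2.arcs.length := by omega
    obtain ⟨-, hout⟩ := ω.2.side_sIn_eq_nth hk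
    rw [hlen1, ω.2.nth_length, hN] at hout
    have hF : ω.2.firstHitG < k := by
      by_contra hge
      have := three_le_Mv hr h; have := fh_add_Mv h; unfold ΩG.Mv at *; omega
    have hlastne : ω.2.fc k ≠ r := fc_ne ω hr h hF hk
    have hrle : r.2 ≤ Y := by
      have e := (fc_fh ω hr h).1
      have := hY ω.2.firstHitG (ω.fh_lt h); rwa [e] at this
    rcases hfc : ω.2.fc k with ⟨x, y⟩
    rw [hfc] at hrow hout hlastne
    simp only at hrow
    have e : r.side ω.1 = .slant x (y + 1) := by rw [← hout]; rfl
    rcases eq_of_side_eq_slant e with ⟨h2, -⟩ | ⟨h2, -⟩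
    · have := congrArg Prod.snd h2; simp only at this; omega
    · refine hlastne (h2.trans ?_).symm; simp

/-- ★ **TOP-ROW PLAQUETTES OF A CLASS-`B2a` WALK ARE SINGLY VISITED**: two arcs of the topmost row in the same plaquette are the same
arc. [cite: GlazmanManolescu2019, §1, Fig. 1; Lemma 2.1] -/
theorem top_single_visit (hh : holeFaceW w ∉ D) (hr : RootedFace D (w.side .W) r) (h : ω.IsB2a) {Y : ℤ}
    (hY : ∀ j < ω.2.arcs.length, (ω.2.fc j).2 ≤ Y) (hYw : w.2 < Y) {i j : ℕ} (hi : i < ω.2.arcs.length)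
    (hj : j < ω.2.arcs.length) (hrow : (ω.2.fc i).2 = Y) (he : ω.2.fc i = ω.2.fc j) : i = j :=
  ω.2.eq_of_fc_eq_of_forall_ne_N (forall_top_ne_N hh hr h hY hYw) hi hj hrow he

/-- ★★ **EXIT TURN OR END IN THE TOP ROW**: besides the entry turn `i₀`, the LAST arc `i₁ ≥ i₀` lying in the topmost row of a wound
class-`B2a` walk EITHER leaves the row through `S` after entering through `W`/`E` — a second turn, in a different (singly visited)
plaquette — OR it is the walk's last arc and the walk ends on a VERTICAL side of `r`, which then lies in the top row (the one
exception of the counting argument). [cite: GlazmanManolescu2019, §1, Fig. 1; Lemma 2.1] [cite: CourantRobbins1958, Ch. V Appendix §2 (the even–odd rule)] -/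
theorem top_exit_or_end (hh : holeFaceW w ∉ D) (hr : RootedFace D (w.side .W) r) (h : ω.IsB2a)
    (hA : ω.AJ hr h (toC (midPt (w.side .W))) ≠ 0) :
    ∃ Y : ℤ, w.2 + 1 ≤ Y ∧ (∀ j < ω.2.arcs.length, (ω.2.fc j).2 ≤ Y) ∧
      ∃ i₀ i₁, 1 ≤ i₀ ∧ i₀ + 1 < ω.2.arcs.length ∧ (ω.2.fc i₀).2 = Y ∧ ω.2.sIn i₀ = .S ∧ (ω.2.sOut i₀ = .W ∨ ω.2.sOut i₀ = .E) ∧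
        i₀ ≤ i₁ ∧ i₁ < ω.2.arcs.length ∧ (ω.2.fc i₁).2 = Y ∧ (∀ j, i₁ < j → j < ω.2.arcs.length → (ω.2.fc j).2 ≠ Y) ∧
        ((ω.2.sOut i₁ = .S ∧ (ω.2.sIn i₁ = .W ∨ ω.2.sIn i₁ = .E) ∧ i₀ ≠ i₁ ∧ ω.2.fc i₀ ≠ ω.2.fc i₁) ∨
          (i₁ + 1 = ω.2.arcs.length ∧ (ω.1 = .W ∨ ω.1 = .E) ∧ r.2 = Y)) := by
  classical
  obtain ⟨Y, hYw, hY, i₀, hi₀1, hi₀2, hrow₀, hS₀, hWE₀⟩ := exists_top_entry_corner hh hr h hA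
  have hex : ∃ n, ∃ i, i < ω.2.arcs.length ∧ (ω.2.fc i).2 = Y ∧ n = ω.2.arcs.length - i :=
    ⟨_, i₀, by omega, hrow₀, rfl⟩
  obtain ⟨i₁, hi₁, hrow₁, hn₁⟩ := Nat.find_spec hex
  have hmax : ∀ j, i₁ < j → j < ω.2.arcs.length → (ω.2.fc j).2 ≠ Y := by
    intro j hj1 hj2 e
    have := Nat.find_min hex (m := ω.2.arcs.length - j) (by omega)
    exact this ⟨j, hj2, e, rfl⟩
  have hi₀le : i₀ ≤ i₁ := by
    by_contra hlt
    exact hmax i₀ (by omega) (by omega) hrow₀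
  have hne := forall_top_ne_N hh hr h hY (by omega)
  -- a top-row TURN at `i₁` through `S` differs from the entry turn and lies in another plaquette
  have hturn : ω.2.sOut i₁ = .S → (ω.2.sIn i₁ = .W ∨ ω.2.sIn i₁ = .E) →
      (ω.2.sOut i₁ = .S ∧ (ω.2.sIn i₁ = .W ∨ ω.2.sIn i₁ = .E) ∧ i₀ ≠ i₁ ∧ ω.2.fc i₀ ≠ ω.2.fc i₁) := by
    intro hS₁ hWE₁
    have hi01 : i₀ ≠ i₁ := by
      rintro rfl
      rcases hWE₁ with e | e <;> rw [hS₀] at e <;> exact absurd e (by decide)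
    exact ⟨hS₁, hWE₁, hi01, fun e => hi01 (top_single_visit hh hr h hY (by omega) (by omega) hi₁ hrow₀ e)⟩
  refine ⟨Y, hYw, hY, i₀, i₁, hi₀1, hi₀2, hrow₀, hS₀, hWE₀, hi₀le, hi₁, hrow₁, hmax, ?_⟩
  by_cases hlast : i₁ + 1 < ω.2.arcs.length
  · have hnext : (ω.2.fc (i₁ + 1)).2 ≠ Y := hmax (i₁ + 1) (by omega) hlast
    obtain ⟨hS₁, hWE₁⟩ := ω.2.sOut_eq_S_of_last_in_row hY hlast (by omega) hrow₁ hnext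
    exact Or.inl (hturn hS₁ hWE₁)
  · have hlen1 : i₁ + 1 = ω.2.arcs.length := by omega
    obtain ⟨-, hout⟩ := ω.2.side_sIn_eq_nth hi₁
    rw [hlen1, ω.2.nth_length] at hout
    have hF : ω.2.firstHitG < i₁ := by
      by_contra hge
      have := three_le_Mv hr h; have := fh_add_Mv h; unfold ΩG.Mv at *; omega
    have hlastne : ω.2.fc i₁ ≠ r := fc_ne ω hr h hF hi₁
    obtain ⟨hNin, hNout⟩ := hne i₁ hi₁ hrow₁
    cases hs : ω.2.sOut i₁
    · right
      rw [hs] at hout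
      rcases hfc : ω.2.fc i₁ with ⟨x, y⟩
      rw [hfc] at hrow₁ hout hlastne
      simp only at hrow₁
      have e : r.side ω.1 = .vert x y := by rw [← hout]; rfl
      rcases eq_of_side_eq_vert e with ⟨h2, hz⟩ | ⟨h2, hz⟩
      · exact absurd h2.symm hlastne
      · exact ⟨hlen1, Or.inr hz, by have := congrArg Prod.snd h2; simp only at this; omega⟩
    · right
      rw [hs] at hout
      rcases hfc : ω.2.fc i₁ with ⟨x, y⟩
      rw [hfc] at hrow₁ hout hlastne
      simp only at hrow₁
      have e : r.side ω.1 = .vert (x + 1) y := by rw [← hout]; rfl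
      rcases eq_of_side_eq_vert e with ⟨h2, hz⟩ | ⟨h2, hz⟩
      · exact ⟨hlen1, Or.inl hz, by have := congrArg Prod.snd h2; simp only at this; omega⟩
      · exact absurd (h2.trans (by simp)).symm hlastne
    · -- the last arc leaves through `S` (returning to `r` from above): it is a TURN
      left
      have hsi := ω.2.sIn_ne_sOut hi₁
      rw [hs] at hsi
      have hWE : ω.2.sIn i₁ = .W ∨ ω.2.sIn i₁ = .E := by
        cases hsi' : ω.2.sIn i₁
        · exact Or.inl rfl
        · exact Or.inr rfl
        · exact absurd hsi' hsi
        · exact absurd hsi' hNin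
      obtain ⟨-, h2, h3, h4⟩ := hturn hs hWE
      exact ⟨rfl, h2, h3, h4⟩
    · exact absurd hs hNout

end ΩG

end Literature.Probability.RandomPlanarGeometry.SAW.YangBaxter
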